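import Literature.Analysis.Fourier.RadialSchwartzInterpolationThm31
import HarnessLib

/-!
# CKMRV interpolation, step 10: Theorem 3.1 with `n₀ = 2` (the `o(e^{−2π Im τ})` clause)

Sibling of `Literature/Analysis/Fourier/RadialSchwartzInterpolation.lean` (the named fact
`CKMRV2022_interpolationFormula` = Cohn–Kumar–Miller–Radchenko–Viazovska, Ann. Math. 196 (2022),
Theorem 1.7). The last clause of CKMRV Theorem 3.1 reads: "Furthermore,
`a₁ = ã₁ = b₁ = b̃₁ = 0` if and only if `F(τ,x)` and `F̃(τ,x)` are `o(e^{−2π Im(τ)})` as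
`Im(τ) → ∞` in the strip `−1 ≤ Re(τ) ≤ 1` with `x` fixed. This last statement concerns starting
the interpolation formula at `n₀ = 2`, which Theorem 1.7 asserts is the case for `d = 24`."
We prove the direction that is used (`o`-decay ⇒ vanishing of the first coefficients,
`coeffG_one_eq_zero`, `coeffA_one_eq_zero`: the coefficient bound `|c₁| ≤ e^{2πt} sup |·(u+it)|`
of step 7 together with the tail estimate `|G_x(σ)| ≤ S e^{−4π Im σ}` once `g₁ = 0`), the
reindexing of an interpolation basis whose `0`-th functions vanish (`IsInterpolationBasis.succ`),
and deduce **Theorem 3.1 with `n₀ = 2`** (`isInterpolationBasis_two_of_generatingFunctions`).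

Everything is proved; no named facts.

## References

* H. Cohn, A. Kumar, S. D. Miller, D. Radchenko, M. Viazovska, *Universal optimality of the `E₈`
  and Leech lattices and interpolation formulas*, Ann. of Math. 196 (2022), §3.1 Theorem 3.1
  (last clause and the remark following it). [CohnEtAl2019]
-/

noncomputable section

open scoped Topology UpperHalfPlane Manifold Real SchwartzMap ContDiff FourierTransform
open Filter Complex UpperHalfPlane Function MeasureTheory Set

namespace Literature.Analysis.Fourier

/-! ## Reindexing an interpolation basis -/

/-- `node (n₀ + 1) n = node n₀ (n + 1)`. [folklore] -/
theorem node_succ (n₀ n : ℕ) : node (n₀ + 1) n = node n₀ (n + 1) := by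
  simp only [node]
  congr 1
  push_cast
  ring

/-- Dropping a vanishing `0`-th term of a series. [folklore] -/
theorem tsum_eq_tsum_succ_of_zero {t : ℕ → ℂ} (hs : Summable fun n => ‖t n‖) (h0 : t 0 = 0) :
    ∑' n, t n = ∑' n, t (n + 1) := by
  rw [hs.of_norm.tsum_eq_zero_add, h0, zero_add]

/-- Shifting a summable sequence. [folklore] -/
theorem summable_succ {t : ℕ → ℝ} (hs : Summable t) : Summable fun n => t (n + 1) :=
  (summable_nat_add_iff 1).2 hs

variable {d : ℕ}


/-- **Reindexing:** an interpolation basis from node `n₀` whose four `0`-th functions vanish is an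
interpolation basis from node `n₀ + 1` after dropping them ("This last statement concerns starting
the interpolation formula at `n₀ = 2`"). [cite: CohnEtAl2019, §3.1 (remark after Theorem 3.1)] -/
theorem IsInterpolationBasis.succ [NeZero d] {n₀ : ℕ} {a b a' b' : ℕ → 𝓢(EuclideanSpace ℝ (Fin d), ℂ)}
    (h : IsInterpolationBasis d n₀ a b a' b') (ha : a 0 = 0) (hb : b 0 = 0) (ha' : a' 0 = 0)
    (hb' : b' 0 = 0) :
    IsInterpolationBasis d (n₀ + 1) (fun n => a (n + 1)) (fun n => b (n + 1)) (fun n => a' (n + 1))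
      (fun n => b' (n + 1)) where
  isRadial_a n := h.isRadial_a _
  isRadial_b n := h.isRadial_b _
  isRadial_a' n := h.isRadial_a' _
  isRadial_b' n := h.isRadial_b' _
  summable_a f hf x := by
    simp only [node_succ]
    exact summable_succ (t := fun m => ‖radialValue f (node n₀ m) * a m x‖) (h.summable_a f hf x)
  summable_b f hf x := by
    simp only [node_succ]
    exact summable_succ (t := fun m => ‖radialDeriv f (node n₀ m) * b m x‖) (h.summable_b f hf x)
  summable_a' f hf x := by
    simp only [node_succ]
    exact summable_succ (t := fun m => ‖radialValue (𝓕 f : 𝓢(EuclideanSpace ℝ (Fin d), ℂ)) (node n₀ m) * a' m x‖)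
      (h.summable_a' f hf x)
  summable_b' f hf x := by
    simp only [node_succ]
    exact summable_succ (t := fun m => ‖radialDeriv (𝓕 f : 𝓢(EuclideanSpace ℝ (Fin d), ℂ)) (node n₀ m) * b' m x‖)
      (h.summable_b' f hf x)
  eq_tsum f hf x := by
    simp only [node_succ]
    rw [h.eq_tsum f hf x,
      tsum_eq_tsum_succ_of_zero (t := fun m => radialValue f (node n₀ m) * a m x) (h.summable_a f hf x)
        (by simp [ha]),
      tsum_eq_tsum_succ_of_zero (t := fun m => radialDeriv f (node n₀ m) * b m x) (h.summable_b f hf x)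
        (by simp [hb]),
      tsum_eq_tsum_succ_of_zero (t := fun m => radialValue (𝓕 f : 𝓢(EuclideanSpace ℝ (Fin d), ℂ)) (node n₀ m) * a' m x)
        (h.summable_a' f hf x) (by simp [ha']),
      tsum_eq_tsum_succ_of_zero (t := fun m => radialDeriv (𝓕 f : 𝓢(EuclideanSpace ℝ (Fin d), ℂ)) (node n₀ m) * b' m x)
        (h.summable_b' f hf x) (by simp [hb'])]

/-! ## Vanishing of the first coefficients under `o(e^{−2π Im τ})` decay -/

section Vanishing

variable {P : Type*} {Fp : ℍ → P → ℂ}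

/-- The `o(e^{−2π Im τ})` hypothesis of the last clause of Theorem 3.1, at the point `x`:
for every `ε > 0`, `‖F(τ,x)‖ ≤ ε e^{−2π Im τ}` for `|Re τ| ≤ 1` and `Im τ` large.
[cite: CohnEtAl2019, §3.1 Theorem 3.1] -/
def IsLittleOExpAt (Fp : ℍ → P → ℂ) (x : P) : Prop :=
  ∀ ε : ℝ, 0 < ε → ∃ T : ℝ, ∀ τ : ℍ, |τ.re| ≤ 1 → T ≤ τ.im →
    ‖Fp τ x‖ ≤ ε * Real.exp (-2 * π * τ.im)

/-- Under `o(e^{−2π Im τ})` decay of `F(·,x)` on the strip, `‖G_x(σ)‖ ≤ 2ε e^{−2π Im σ}` for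
`0 ≤ Re σ ≤ 1` and `Im σ ≥ T` (periodicity of `G_x` and `G_x(σ−1) = F(σ,x) − F(σ−1,x)`). [folklore] -/
theorem norm_shiftDiff_le_of_littleO (hFE : ∀ τ x, Fp ((2 : ℝ) +ᵥ τ) x - 2 * Fp ((1 : ℝ) +ᵥ τ) x + Fp τ x = 0)
    {x : P} {ε T : ℝ}
    (hT : ∀ τ : ℍ, |τ.re| ≤ 1 → T ≤ τ.im → ‖Fp τ x‖ ≤ ε * Real.exp (-2 * π * τ.im))
    {σ : ℍ} (h0 : 0 ≤ σ.re) (h1 : σ.re ≤ 1) (hσT : T ≤ σ.im) :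
    ‖shiftDiff (fun τ => Fp τ x) σ‖ ≤ 2 * ε * Real.exp (-2 * π * σ.im) := by
  have hFEx : ∀ τ : ℍ, Fp ((2 : ℝ) +ᵥ τ) x - 2 * Fp ((1 : ℝ) +ᵥ τ) x + Fp τ x = 0 := fun τ => hFE τ x
  -- as in `norm_shiftDiff_le`, with the sharper bound
  set ρ : ℍ := ((-1 : ℝ)) +ᵥ σ with hρ
  have hρre : ρ.re = σ.re - 1 := by simp [hρ, vadd_re]; ring
  have hρim : ρ.im = σ.im := by simp [hρ, vadd_im]
  have hper : shiftDiff (fun τ => Fp τ x) σ = shiftDiff (fun τ => Fp τ x) ρ := by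
    rw [← shiftDiff_one_vadd hFEx ρ, one_vadd_neg_one_vadd]
  have hG : shiftDiff (fun τ => Fp τ x) ρ = Fp σ x - Fp ρ x := by
    simp only [shiftDiff, hρ, one_vadd_neg_one_vadd]
  rw [hper, hG]
  have hσs : |σ.re| ≤ 1 := abs_le.2 ⟨by linarith, h1⟩
  have hρs : |ρ.re| ≤ 1 := by rw [hρre]; exact abs_le.2 ⟨by linarith, by linarith⟩
  calc ‖Fp σ x - Fp ρ x‖ ≤ ‖Fp σ x‖ + ‖Fp ρ x‖ := norm_sub_le _ _
    _ ≤ ε * Real.exp (-2 * π * σ.im) + ε * Real.exp (-2 * π * ρ.im) :=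
        add_le_add (hT σ hσs hσT) (hT ρ hρs (by rw [hρim]; exact hσT))
    _ = 2 * ε * Real.exp (-2 * π * σ.im) := by rw [hρim]; ring

/-- **`g₁(x) = 0` under `o`-decay** (CKMRV Theorem 3.1, last clause: `b₁ = 0`):
`‖g₁‖ ≤ e^{2πt} sup_u ‖G_x(u+it)‖ ≤ 2ε` for all `ε`. [cite: CohnEtAl2019, §3.1 Theorem 3.1] -/
theorem coeffG_one_eq_zero (hh : ∀ x, MDiff fun τ => Fp τ x)
    (hFE : ∀ τ x, Fp ((2 : ℝ) +ᵥ τ) x - 2 * Fp ((1 : ℝ) +ᵥ τ) x + Fp τ x = 0)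
    {α β : ℝ} (hβ : 0 < β) (h4 : ∀ τ x, |τ.re| ≤ 1 → ‖Fp τ x‖ ≤ α * τ.im ^ (-β)) {x : P}
    (ho : IsLittleOExpAt Fp x) : coeffG Fp 1 x = 0 := by
  have hFEx : ∀ τ : ℍ, Fp ((2 : ℝ) +ᵥ τ) x - 2 * Fp ((1 : ℝ) +ᵥ τ) x + Fp τ x = 0 := fun τ => hFE τ x
  have h4x : ∀ τ : ℍ, |τ.re| ≤ 1 → ‖Fp τ x‖ ≤ α * τ.im ^ (-β) := fun τ hτ => h4 τ x hτ
  rw [coeffG_eq_qExpansion_coeff hh hFE hβ h4]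
  rw [← norm_le_zero_iff]
  refine le_of_forall_pos_le_add fun ε hε => ?_
  rw [zero_add]
  obtain ⟨T, hT⟩ := ho (ε / 2) (half_pos hε)
  set t : ℝ := max T 1 with ht
  have ht0 : 0 < t := lt_of_lt_of_le one_pos (le_max_right _ _)
  have h := norm_qExpansion_coeff_le (periodic_shiftDiff hFEx) (mdifferentiable_shiftDiff (hh x))
    (isZeroAtImInfty_shiftDiff hFEx hβ h4x).isBoundedAtImInfty 1 ht0
    (M := 2 * (ε / 2) * Real.exp (-2 * π * t)) (fun τ him h0 h1 => by
      have := norm_shiftDiff_le_of_littleO hFE hT h0 h1 (by rw [him]; exact le_max_left _ _)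
      rwa [him] at this)
  refine h.trans (le_of_eq ?_)
  rw [Nat.cast_one, mul_one, show 2 * (ε / 2) = ε by ring, mul_left_comm, ← Real.exp_add]
  simp

/-- Polynomial growth of the `q`-expansion coefficients of `G_x` (all `n ≥ 1`). [folklore] -/
theorem norm_qExpansion_coeff_shiftDiff_le (hh : ∀ x, MDiff fun τ => Fp τ x)
    (hFE : ∀ τ x, Fp ((2 : ℝ) +ᵥ τ) x - 2 * Fp ((1 : ℝ) +ᵥ τ) x + Fp τ x = 0)
    {α β : ℝ} (hβ : 0 < β) (h4 : ∀ τ x, |τ.re| ≤ 1 → ‖Fp τ x‖ ≤ α * τ.im ^ (-β)) (x : P)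
    {n : ℕ} (hn : 1 ≤ n) :
    ‖(qExpansion 1 (shiftDiff (fun τ => Fp τ x))).coeff n‖ ≤ Real.exp (2 * π) * (2 * α) * (n : ℝ) ^ β := by
  have hFEx : ∀ τ : ℍ, Fp ((2 : ℝ) +ᵥ τ) x - 2 * Fp ((1 : ℝ) +ᵥ τ) x + Fp τ x = 0 := fun τ => hFE τ x
  have h4x : ∀ τ : ℍ, |τ.re| ≤ 1 → ‖Fp τ x‖ ≤ α * τ.im ^ (-β) := fun τ hτ => h4 τ x hτ
  exact norm_qExpansion_coeff_le_of_strip (periodic_shiftDiff hFEx) (mdifferentiable_shiftDiff (hh x))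
    (isZeroAtImInfty_shiftDiff hFEx hβ h4x).isBoundedAtImInfty
    (fun τ h0 h1 _ => by
      have := norm_shiftDiff_le hFEx h4x h0 h1
      linarith) hn

/-- **Tail estimate:** once `g₁(x) = 0`, `‖G_x(σ)‖ ≤ S e^{−4π Im σ}` for `Im σ ≥ 1`, with
`S = ∑_{n} ‖g_{n+2}‖ e^{−2πn} < ∞`. [folklore] -/
theorem exists_norm_shiftDiff_le_exp (hh : ∀ x, MDiff fun τ => Fp τ x)
    (hFE : ∀ τ x, Fp ((2 : ℝ) +ᵥ τ) x - 2 * Fp ((1 : ℝ) +ᵥ τ) x + Fp τ x = 0)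
    {α β : ℝ} (hβ : 0 < β) (h4 : ∀ τ x, |τ.re| ≤ 1 → ‖Fp τ x‖ ≤ α * τ.im ^ (-β)) {x : P}
    (hg1 : (qExpansion 1 (shiftDiff (fun τ => Fp τ x))).coeff 1 = 0) :
    ∃ S : ℝ, 0 ≤ S ∧ ∀ σ : ℍ, 1 ≤ σ.im →
      ‖shiftDiff (fun τ => Fp τ x) σ‖ ≤ S * Real.exp (-4 * π * σ.im) := by
  set c : ℕ → ℂ := fun n => (qExpansion 1 (shiftDiff (fun τ => Fp τ x))).coeff n with hc
  have hFEx : ∀ τ : ℍ, Fp ((2 : ℝ) +ᵥ τ) x - 2 * Fp ((1 : ℝ) +ᵥ τ) x + Fp τ x = 0 := fun τ => hFE τ x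
  have h4x : ∀ τ : ℍ, |τ.re| ≤ 1 → ‖Fp τ x‖ ≤ α * τ.im ^ (-β) := fun τ hτ => h4 τ x hτ
  have hα : 0 ≤ α := by
    have h := h4x UpperHalfPlane.I (by simp)
    have : (0 : ℝ) < UpperHalfPlane.I.im ^ (-β) := Real.rpow_pos_of_pos (by simp) _
    nlinarith [norm_nonneg (Fp UpperHalfPlane.I x)]
  -- the weights `w n = ‖c (n+2)‖ e^{-2πn}` are summable
  set N : ℕ := ⌈β⌉₊ with hN
  set r : ℝ := Real.exp (-2 * π) with hr
  have hr0 : 0 ≤ r := (Real.exp_pos _).le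
  have hr1 : r < 1 := by rw [hr, Real.exp_lt_one_iff]; nlinarith [Real.pi_pos]
  set K : ℝ := Real.exp (2 * π) * (2 * α) * 2 ^ N with hK
  have hcoeff : ∀ n : ℕ, ‖c (n + 2)‖ ≤ K * (1 + (n : ℝ)) ^ N := by
    intro n
    refine (norm_qExpansion_coeff_shiftDiff_le hh hFE hβ h4 x (n := n + 2) (by omega)).trans ?_
    have h1 : ((n + 2 : ℕ) : ℝ) ^ β ≤ ((n + 2 : ℕ) : ℝ) ^ (N : ℝ) :=
      Real.rpow_le_rpow_of_exponent_le (by push_cast; linarith [(Nat.cast_nonneg n : (0:ℝ) ≤ n)])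
        (Nat.le_ceil β)
    rw [Real.rpow_natCast] at h1
    have h2 : ((n + 2 : ℕ) : ℝ) ^ N ≤ 2 ^ N * (1 + (n : ℝ)) ^ N := by
      rw [← mul_pow]; push_cast
      exact pow_le_pow_left₀ (by positivity) (by linarith [(Nat.cast_nonneg n : (0:ℝ) ≤ n)]) N
    calc Real.exp (2 * π) * (2 * α) * ((n + 2 : ℕ) : ℝ) ^ β
        ≤ Real.exp (2 * π) * (2 * α) * (2 ^ N * (1 + (n : ℝ)) ^ N) :=
          mul_le_mul_of_nonneg_left (h1.trans h2) (by positivity)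
      _ = K * (1 + (n : ℝ)) ^ N := by rw [hK]; ring
  set w : ℕ → ℝ := fun n => ‖c (n + 2)‖ * r ^ n with hw
  have hws : Summable w := by
    refine Summable.of_nonneg_of_le (fun n => by positivity) (fun n => ?_)
      ((summable_one_add_pow_mul_geometric hr0 hr1 N).mul_left K)
    simp only [hw]
    calc ‖c (n + 2)‖ * r ^ n ≤ K * (1 + (n : ℝ)) ^ N * r ^ n :=
          mul_le_mul_of_nonneg_right (hcoeff n) (by positivity)
      _ = K * ((1 + (n : ℝ)) ^ N * r ^ n) := by ring
  refine ⟨∑' n, w n, tsum_nonneg fun n => by positivity, fun σ hσ => ?_⟩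
  -- the expansion of `G σ` without its first two terms
  have hsum := hasSum_shiftDiff (hh x) hFEx hβ h4x σ
  have hsum2 : HasSum (fun n : ℕ => c (n + 2) * Periodic.qParam 1 σ ^ (n + 2))
      (shiftDiff (fun τ => Fp τ x) σ) := by
    have h := (hasSum_nat_add_iff' 1 (f := fun n : ℕ => c (n + 1) * Periodic.qParam 1 σ ^ (n + 1))).2 hsum
    simp only [Finset.range_one, Finset.sum_singleton, zero_add] at h
    rw [show c 1 = 0 from hg1, zero_mul, sub_zero] at h
    exact h
  rw [← hsum2.tsum_eq]
  refine tsum_of_norm_bounded (hws.hasSum.mul_right (Real.exp (-4 * π * σ.im))) fun n => ?_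
  rw [norm_mul, norm_pow, Periodic.norm_qParam, div_one]
  simp only [hw]
  have hq : Real.exp (-2 * π * (σ : ℂ).im) ^ (n + 2) ≤ r ^ n * Real.exp (-4 * π * σ.im) := by
    rw [UpperHalfPlane.coe_im, ← Real.exp_nat_mul, hr, ← Real.exp_nat_mul, ← Real.exp_add, Real.exp_le_exp]
    push_cast
    nlinarith [Real.pi_pos, mul_nonneg (Nat.cast_nonneg n : (0:ℝ) ≤ n) Real.pi_pos.le]
  calc ‖c (n + 2)‖ * Real.exp (-2 * π * (σ : ℂ).im) ^ (n + 2)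
      ≤ ‖c (n + 2)‖ * (r ^ n * Real.exp (-4 * π * σ.im)) :=
        mul_le_mul_of_nonneg_left hq (norm_nonneg _)
    _ = ‖c (n + 2)‖ * r ^ n * Real.exp (-4 * π * σ.im) := by ring

/-- **`a₁(x) = 0` under `o`-decay** (CKMRV Theorem 3.1, last clause: `a₁ = 0`): for `Im τ = t`
large, `e^{2πt} ‖H_x‖ ≤ ε + S/t` on the period strip. [cite: CohnEtAl2019, §3.1 Theorem 3.1] -/
theorem coeffA_one_eq_zero (hh : ∀ x, MDiff fun τ => Fp τ x)
    (hFE : ∀ τ x, Fp ((2 : ℝ) +ᵥ τ) x - 2 * Fp ((1 : ℝ) +ᵥ τ) x + Fp τ x = 0)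
    {α β : ℝ} (hβ : 0 < β) (h4 : ∀ τ x, |τ.re| ≤ 1 → ‖Fp τ x‖ ≤ α * τ.im ^ (-β)) {x : P}
    (ho : IsLittleOExpAt Fp x) : coeffA Fp 1 x = 0 := by
  have hFEx : ∀ τ : ℍ, Fp ((2 : ℝ) +ᵥ τ) x - 2 * Fp ((1 : ℝ) +ᵥ τ) x + Fp τ x = 0 := fun τ => hFE τ x
  have h4x : ∀ τ : ℍ, |τ.re| ≤ 1 → ‖Fp τ x‖ ≤ α * τ.im ^ (-β) := fun τ hτ => h4 τ x hτ
  have hg1 : (qExpansion 1 (shiftDiff (fun τ => Fp τ x))).coeff 1 = 0 := by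
    rw [← coeffG_eq_qExpansion_coeff hh hFE hβ h4]; exact coeffG_one_eq_zero hh hFE hβ h4 ho
  obtain ⟨S, hS0, hS⟩ := exists_norm_shiftDiff_le_exp hh hFE hβ h4 hg1
  rw [coeffA_eq_qExpansion_coeff hh hFE hβ h4, ← norm_le_zero_iff]
  refine le_of_forall_pos_le_add fun ε hε => ?_
  rw [zero_add]
  obtain ⟨T, hT⟩ := ho (ε / 2) (half_pos hε)
  -- choose the height `t`
  set t : ℝ := max (max T 1) (2 * S / ε + 1) with ht
  have ht1 : 1 ≤ t := (le_max_right T 1).trans (le_max_left _ _)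
  have ht0 : 0 < t := by linarith
  have htT : T ≤ t := (le_max_left T 1).trans (le_max_left _ _)
  have htS : S / t ≤ ε / 2 := by
    rw [div_le_iff₀ ht0]
    have : 2 * S / ε + 1 ≤ t := le_max_right _ _
    have h' : 2 * S / ε * ε = 2 * S := by field_simp
    nlinarith
  -- the bound on `H` along `Im τ = t`, `0 ≤ Re τ ≤ 1`
  have hH : ∀ τ : ℍ, τ.im = t → 0 ≤ τ.re → τ.re ≤ 1 →
      ‖shiftRem (fun σ => Fp σ x) τ‖ ≤ (ε / 2 + S / t) * Real.exp (-2 * π * t) := by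
    intro τ him h0 h1
    set ρ : ℍ := ((-1 : ℝ)) +ᵥ τ with hρ
    have hρre : ρ.re = τ.re - 1 := by simp [hρ, vadd_re]; ring
    have hρim : ρ.im = t := by simp [hρ, vadd_im, him]
    have hper : shiftRem (fun σ => Fp σ x) τ = shiftRem (fun σ => Fp σ x) ρ := by
      rw [← shiftRem_one_vadd hFEx ρ, one_vadd_neg_one_vadd]
    have hρs : |ρ.re| ≤ 1 := by rw [hρre]; exact abs_le.2 ⟨by linarith, by linarith⟩
    have hnρ : ‖(ρ : ℂ)‖ ≤ 1 + t := by
      refine (norm_le_abs_re_add_abs_im _).trans ?_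
      rw [UpperHalfPlane.coe_re, UpperHalfPlane.coe_im, hρim, abs_of_pos ht0]
      linarith
    rw [hper, shiftRem]
    have hGρ := hS ρ (by rw [hρim]; exact ht1)
    rw [hρim] at hGρ
    have hFρ := hT ρ hρs (by rw [hρim]; exact htT)
    rw [hρim] at hFρ
    have h3 : (1 + t) * Real.exp (-4 * π * t) ≤ (1 / t) * Real.exp (-2 * π * t) := by
      have := one_add_mul_exp_neg_two_pi_le ht1
      rw [show -4 * π * t = -2 * π * t + -2 * π * t by ring, Real.exp_add, ← mul_assoc]
      exact mul_le_mul_of_nonneg_right this (Real.exp_pos _).le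
    calc ‖Fp ρ x - (ρ : ℂ) * shiftDiff (fun σ => Fp σ x) ρ‖
        ≤ ‖Fp ρ x‖ + ‖(ρ : ℂ)‖ * ‖shiftDiff (fun σ => Fp σ x) ρ‖ := by
          refine (norm_sub_le _ _).trans ?_; rw [norm_mul]
      _ ≤ ε / 2 * Real.exp (-2 * π * t) + (1 + t) * (S * Real.exp (-4 * π * t)) :=
          add_le_add hFρ (mul_le_mul hnρ hGρ (norm_nonneg _) (by positivity))
      _ = ε / 2 * Real.exp (-2 * π * t) + S * ((1 + t) * Real.exp (-4 * π * t)) := by ring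
      _ ≤ ε / 2 * Real.exp (-2 * π * t) + S * ((1 / t) * Real.exp (-2 * π * t)) :=
          add_le_add le_rfl (mul_le_mul_of_nonneg_left h3 hS0)
      _ = (ε / 2 + S / t) * Real.exp (-2 * π * t) := by ring
  have h := norm_qExpansion_coeff_le (periodic_shiftRem hFEx) (mdifferentiable_shiftRem (hh x))
    (isZeroAtImInfty_shiftRem (hh x) hFEx hβ h4x).isBoundedAtImInfty 1 ht0 hH
  refine h.trans ?_
  rw [Nat.cast_one, mul_one, mul_left_comm, ← Real.exp_add, show 2 * π * t + -2 * π * t = 0 by ring,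
    Real.exp_zero, mul_one]
  linarith

end Vanishing

/-! ## CKMRV Theorem 3.1 with `n₀ = 2` -/

variable [NeZero d]

/-- **CKMRV Theorem 3.1, `n₀ = 2`:** under the hypotheses of Theorem 3.1
(`isInterpolationBasis_of_generatingFunctions`) and, in addition, `F(τ,x), F̃(τ,x) = o(e^{−2π Im τ})`
as `Im τ → ∞` in the strip `|Re τ| ≤ 1` for each fixed `x` (`IsLittleOExpAt`), the first basis
functions vanish (`a₁ = b₁ = ã₁ = b̃₁ = 0`) and the interpolation formula starts at `n₀ = 2`: there
is an interpolation basis `(aₙ, bₙ, ãₙ, b̃ₙ)_{n ≥ 2}` ("This last statement concerns starting the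
interpolation formula at `n₀ = 2`, which Theorem 1.7 asserts is the case for `d = 24`").
[cite: CohnEtAl2019, §3.1 Theorem 3.1 (last clause)] -/
theorem isInterpolationBasis_two_of_generatingFunctions {F Ft : ℍ → EuclideanSpace ℝ (Fin d) → ℂ}
    (hF : IsGeneratingFamily F) (hFt : IsGeneratingFamily Ft)
    (hFrad : ∀ τ, IsRadial (F τ)) (hFtrad : ∀ τ, IsRadial (Ft τ))
    (hFo : ∀ x, IsLittleOExpAt F x) (hFto : ∀ x, IsLittleOExpAt Ft x)
    (hFE : ∀ (τ : ℍ) (x : EuclideanSpace ℝ (Fin d)), F τ x + (Complex.I / (τ : ℂ)) ^ ((d : ℂ) / 2) *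
      Ft (UpperHalfPlane.negInv τ) x = cexp (π * Complex.I * (τ : ℂ) * ‖x‖ ^ 2)) :
    ∃ a b a' b' : ℕ → 𝓢(EuclideanSpace ℝ (Fin d), ℂ), IsInterpolationBasis d 2 a b a' b' := by
  obtain ⟨α, β, hβ, h4⟩ := hF.strip
  obtain ⟨αt, βt, hβt, h4t⟩ := hFt.strip
  obtain ⟨a, g, ha, hg, -, -, hexp, hgrowth, hrad⟩ := exists_schwartz_coefficients hF.smooth hF.cont hF.hol
    hF.shift_sq hF.growth hβ h4
  obtain ⟨a', g', ha', hg', -, -, hexp', hgrowth', hrad'⟩ := exists_schwartz_coefficients hFt.smooth hFt.cont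
    hFt.hol hFt.shift_sq hFt.growth hβt h4t
  have hgen : ∀ (τ : ℍ) (x : EuclideanSpace ℝ (Fin d)),
      genFun 1 (fun n => ⇑(a n)) (fun n => ⇑(bOfG g n)) τ x = F τ x :=
    genFun_eq_of_expansion hexp
  have hgen' : ∀ (τ : ℍ) (x : EuclideanSpace ℝ (Fin d)),
      genFun 1 (fun n => ⇑(a' n)) (fun n => ⇑(bOfG g' n)) τ x = Ft τ x :=
    genFun_eq_of_expansion hexp'
  have hbasis : IsInterpolationBasis d 1 a (bOfG g) a' (bOfG g') := by
    refine IsInterpolationBasis.of_functionalEquation le_rfl (fun n => (hrad hFrad n).1)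
      (fun n => isRadial_bOfG (fun n => (hrad hFrad n).2) n) (fun n => (hrad' hFtrad n).1)
      (fun n => isRadial_bOfG (fun n => (hrad' hFtrad n).2) n) (fun x => ?_) (fun τ x => ?_)
    · obtain ⟨C, N, hCN⟩ := hgrowth x
      obtain ⟨C', N', hCN'⟩ := hgrowth' x
      have hC : 0 ≤ C := le_trans (norm_nonneg _) (by simpa using (hCN 0).1)
      have hC' : 0 ≤ C' := le_trans (norm_nonneg _) (by simpa using (hCN' 0).1)
      refine ⟨C + C', N + N', fun n => ?_⟩
      have h1 : ∀ n : ℕ, C * (1 + (n : ℝ)) ^ N ≤ (C + C') * (1 + n) ^ (N + N') := fun n =>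
        mul_le_mul (by linarith) (pow_le_pow_right₀ (by linarith [(Nat.cast_nonneg n : (0:ℝ) ≤ n)])
          (by omega)) (by positivity) (by positivity)
      have h2 : ∀ n : ℕ, C' * (1 + (n : ℝ)) ^ N' ≤ (C + C') * (1 + n) ^ (N + N') := fun n =>
        mul_le_mul (by linarith) (pow_le_pow_right₀ (by linarith [(Nat.cast_nonneg n : (0:ℝ) ≤ n)])
          (by omega)) (by positivity) (by positivity)
      exact ⟨(hCN n).1.trans (h1 n), ((norm_bOfG_le g n x).trans (hCN n).2).trans (h1 n),
        (hCN' n).1.trans (h2 n), ((norm_bOfG_le g' n x).trans (hCN' n).2).trans (h2 n)⟩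
    · have h := hFE τ x
      rw [← hgen τ x, ← hgen' (UpperHalfPlane.negInv τ) x, UpperHalfPlane.coe_negInv] at h
      exact h
  -- the first functions vanish
  have ha0 : a 0 = 0 := by
    ext x; rw [ha, FunLike.coe_zero, Pi.zero_apply]; exact coeffA_one_eq_zero hF.hol hF.shift_sq hβ h4 (hFo x)
  have hg0 : g 0 = 0 := by
    ext x; rw [hg, FunLike.coe_zero, Pi.zero_apply]; exact coeffG_one_eq_zero hF.hol hF.shift_sq hβ h4 (hFo x)
  have ha0' : a' 0 = 0 := by
    ext x; rw [ha', FunLike.coe_zero, Pi.zero_apply]; exact coeffA_one_eq_zero hFt.hol hFt.shift_sq hβt h4t (hFto x)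
  have hg0' : g' 0 = 0 := by
    ext x; rw [hg', FunLike.coe_zero, Pi.zero_apply]; exact coeffG_one_eq_zero hFt.hol hFt.shift_sq hβt h4t (hFto x)
  have hb0 : bOfG g 0 = 0 := by rw [bOfG, hg0, smul_zero]
  have hb0' : bOfG g' 0 = 0 := by rw [bOfG, hg0', smul_zero]
  exact ⟨_, _, _, _, hbasis.succ ha0 hb0 ha0' hb0'⟩

/-! ## The reduction of the named fact to the generating functions of §4–§5 -/

/-- **Reduction of CKMRV Theorem 1.7 to the existence of the generating functions** (this is how
the printed proof is organised: "Theorem 3.1 reduces Theorem 1.7 to constructing `F` and `F̃`";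
§4 (Theorem 4.1) and §5 construct them from weakly holomorphic quasimodular forms for `Γ(2)`).
If for `d = 8` there are `F, F̃` as in Theorem 3.1 (`IsGeneratingFamily`, radial, satisfying
`F(τ,x) + (i/τ)⁴ F̃(−1/τ,x) = e^{πiτ|x|²}`), and for `d = 24` there are such `F, F̃` (with
`(i/τ)^{12}`) that are moreover `o(e^{−2π Im τ})` on the strip, then the named fact
`CKMRV2022_interpolationFormula` holds. This theorem carries its hypotheses explicitly; it does
not discharge the fact. [cite: CohnEtAl2019, §3.1 Theorem 3.1 and §1.6 ("Section 3 shows how to reduce the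
interpolation theorem to the existence of generating functions")] -/
theorem ckmrv2022_interpolationFormula_of_generatingFunctions
    (h8 : ∃ F Ft : ℍ → EuclideanSpace ℝ (Fin 8) → ℂ, IsGeneratingFamily F ∧ IsGeneratingFamily Ft ∧
      (∀ τ, IsRadial (F τ)) ∧ (∀ τ, IsRadial (Ft τ)) ∧
      ∀ (τ : ℍ) (x : EuclideanSpace ℝ (Fin 8)), F τ x + (Complex.I / (τ : ℂ)) ^ (((8 : ℕ) : ℂ) / 2) *
        Ft (UpperHalfPlane.negInv τ) x = cexp (π * Complex.I * (τ : ℂ) * ‖x‖ ^ 2))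
    (h24 : ∃ F Ft : ℍ → EuclideanSpace ℝ (Fin 24) → ℂ, IsGeneratingFamily F ∧ IsGeneratingFamily Ft ∧
      (∀ τ, IsRadial (F τ)) ∧ (∀ τ, IsRadial (Ft τ)) ∧
      (∀ x, IsLittleOExpAt F x) ∧ (∀ x, IsLittleOExpAt Ft x) ∧
      ∀ (τ : ℍ) (x : EuclideanSpace ℝ (Fin 24)), F τ x + (Complex.I / (τ : ℂ)) ^ (((24 : ℕ) : ℂ) / 2) *
        Ft (UpperHalfPlane.negInv τ) x = cexp (π * Complex.I * (τ : ℂ) * ‖x‖ ^ 2)) :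
    CKMRV2022_interpolationFormula := by
  obtain ⟨F, Ft, hF, hFt, hr, hrt, hFE⟩ := h8
  obtain ⟨F', Ft', hF', hFt', hr', hrt', ho, hot, hFE'⟩ := h24
  obtain ⟨a, b, a', b', hb, -, -⟩ := isInterpolationBasis_of_generatingFunctions hF hFt hr hrt hFE
  obtain ⟨c, e, c', e', hb'⟩ := isInterpolationBasis_two_of_generatingFunctions hF' hFt' hr' hrt' ho hot hFE'
  exact ⟨⟨a, b, a', b', hb⟩, ⟨c, e, c', e', hb'⟩⟩

end Literature.Analysis.Fourier
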